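import Summits.Ventures.PercRepro.Night2LocalR1ColA

/-!
# PercRepro — R1 columns, II: the sets with `|S ∖ {y}| = 4`, structure and the case without a collinear triple (night-2, gen 10)

`U := S ∖ {y}` has four points and rank `3`.  The spreading members of `S` (`sprPre`) are either the triangles
`U ∖ {x}` (`eq_erase_of_mem_sprPre_notMem`) or sets `K ∪ {y}` with `K ⊆ U` a pair whose line misses at most one
point of `P = G ∖ {y}` — which forces a collinear triple `U ∖ {x} ⊆ cl K` (`line_of_mem_sprPre_mem`).  The covering
coloops of `S` other than `y` give collinear triples `U ∖ {z}` (`rkN_erase_le_two_of_mem_covZ`) — at most one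
(`eq_of_rkN_erase_le_two`, from `card_filter_rkN_erase_eq_two_le_one`).

* no collinear triple in `U`: column `≤ 5/12·[U a member] + 4·(5/12)/(|G| − 4) ≤ 35/36`
  (`sum_r1W_col_le_of_card_four_of_no_collinear`).

The file ends with the facts about a collinear triple `K₀ = U ∖ {z₀}` used by the two remaining cases
(`Night2LocalR1ColC`: its line misses one point of `P`; `Night2LocalR1ColD`: it misses `≥ 2`).
-/
namespace PercRepro.Shadow

open Finset PerFlat ThmH

variable {α : Type*} [DecidableEq α] {M : Matroid α} [M.Finite]

/-! ## Closures -/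

omit [DecidableEq α] in
/-- `cl (cl X) = cl X`. -/
theorem clF_clF (X : Finset α) : clF M (clF M X) = clF M X := by
  rw [← Finset.coe_inj, coe_clF, coe_clF, M.closure_closure]

/-- A rank-`2` subset of a rank-`2` set has the same closure. -/
theorem clF_eq_clF_of_subset_of_rkN_two {K K₀ : Finset α} (_hK₀ : K₀ ⊆ gr M) (hK : K ⊆ K₀)
    (hKr : rkN M K = 2) (hK₀r : rkN M K₀ = 2) : clF M K = clF M K₀ := by
  have hL : clF M K₀ ∈ flatsQ M 2 := by
    rw [mem_flatsQ]
    refine ⟨?_, ?_, ?_⟩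
    · rw [← Finset.coe_subset, coe_clF, coe_gr]; exact M.closure_subset_ground _
    · rw [coe_clF]; exact M.isFlat_closure _
    · rw [coe_clF, M.eRk_closure_eq, eRk_eq_rkN, hK₀r]
  apply flat_eq_of_subset_of_eRk_eq (q := 1) hL _ (clF_mono hK)
  · rw [coe_clF, M.eRk_closure_eq, eRk_eq_rkN, hKr]
  · rw [coe_clF]; exact M.isFlat_closure _

/-- `|G ∖ cl B| = 1` with `cl B ⊆ G` means `cl B = G ∖ {w}` for the element `w` of `G ∖ cl B`. -/
theorem clF_eq_erase_of_sdiff_eq_singleton {G B : Finset α} {w : α} (hclB : clF M B ⊆ G)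
    (hsd : G \ clF M B = {w}) : clF M B = G.erase w := by
  ext e
  rw [Finset.mem_erase]
  constructor
  · intro he
    refine ⟨?_, hclB he⟩
    rintro rfl
    have : e ∈ G \ clF M B := hsd ▸ Finset.mem_singleton_self e
    exact (Finset.mem_sdiff.1 this).2 he
  · rintro ⟨hew, heG⟩
    by_contra h
    have : e ∈ G \ clF M B := Finset.mem_sdiff.2 ⟨heG, h⟩
    rw [hsd, Finset.mem_singleton] at this
    exact hew this

/-! ## A side sum bounded by one uncounted-sides argument -/

open scoped Classical in
/-- **Two uncounted sides**: if `B = {w', a, b}` (`|B| = 3`, `w' ∈ B`), `G ∖ cl B = {w}` and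
`cl B ⊆ insert w' (cl (B ∖ {w'}))`, then only the side `B ∖ {w'}` can be counted and `sideSum B ≤ 5/12`. -/
theorem sideSum_le_of_subset_insert {G B : Finset α} (hBg : B ⊆ gr M) (hB3 : B.card = 3) (hr : rkN M B = 3)
    (hclB : clF M B ⊆ G) {w : α} (hsd : G \ clF M B = {w}) {w' : α} (hw' : w' ∈ B)
    (hP : clF M B ⊆ insert w' (clF M (B.erase w'))) : sideSum M G B ≤ 5 / 12 := by
  have hcl : clF M B = G.erase w := clF_eq_erase_of_sdiff_eq_singleton hclB hsd
  unfold sideSum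
  set F := (B.powersetCard 2).filter (fun K => 3 ≤ rkN M (G \ (K ∪ (G \ clF M B)))) with hF
  have h2 : (B.erase w').card = 2 := by rw [Finset.card_erase_of_mem hw', hB3]
  obtain ⟨a, b, hab, hab'⟩ := Finset.card_eq_two.1 h2
  have hBeq : B = insert w' (B.erase w') := (Finset.insert_erase hw').symm
  have hFsub : F ⊆ {B.erase w'} := by
    intro K hK
    rw [hF, Finset.mem_filter, Finset.mem_powersetCard, hsd, sdiff_union_singleton, ← hcl] at hK
    obtain ⟨⟨hKB, hK2⟩, hKr⟩ := hK
    rw [Finset.mem_singleton]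
    by_contra hne
    obtain ⟨d, hd, hKcd⟩ := eq_pair_of_ne (Finset.notMem_erase w' B) hBeq h2 hKB hK2 hne
    rw [hab'] at hd hP
    rw [Finset.mem_insert, Finset.mem_singleton] at hd
    rw [hKcd, Finset.pair_comm] at hKr
    rcases hd with rfl | rfl
    · have := rkN_sdiff_le_two_of_subset_insert_clF hP
      omega
    · rw [Finset.pair_comm] at hP
      have := rkN_sdiff_le_two_of_subset_insert_clF hP
      omega
  calc ∑ K ∈ F, (5 / 4) / (((clF M B \ clF M K).card : ℚ) + 2)
      ≤ ∑ K ∈ ({B.erase w'} : Finset (Finset α)), (5 / 4) / (((clF M B \ clF M K).card : ℚ) + 2) := by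
        apply Finset.sum_le_sum_of_subset_of_nonneg hFsub
        intro K _ _
        exact div_nonneg (by norm_num) (add_nonneg (Nat.cast_nonneg _) (by norm_num))
    _ = (5 / 4) / (((clF M B \ clF M (B.erase w')).card : ℚ) + 2) := Finset.sum_singleton _ _
    _ ≤ 5 / 12 := by
        have h1 := one_le_card_clF_sdiff_of_card_two hBg hr h2
        have h1' : (1 : ℚ) ≤ ((clF M B \ clF M (B.erase w')).card : ℚ) := by exact_mod_cast h1
        rw [div_le_iff₀ (by linarith)]
        linarith

/-! ## The structure of `sprPre` and `covZ` at `|U| = 4` -/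

/-- A spreading member with `y ∉ B` is a triangle `U ∖ {x}`. -/
theorem eq_erase_of_mem_sprPre_notMem {G S : Finset α} {y : α} (_hyS : y ∈ S) (h4 : (S.erase y).card = 4)
    {B : Finset α} (hB : B ∈ sprPre M G S) (hyB : y ∉ B) :
    ∃ x ∈ S.erase y, B = (S.erase y).erase x ∧ rkN M B = 3 := by
  obtain ⟨hBS, -⟩ := card_eq_five_of_mem_sprPre hB
  have hB3 : B.card = 3 := (Finset.mem_filter.1 hB).2.2.1
  have hBU : B ⊆ S.erase y := fun e he => Finset.mem_erase.2 ⟨fun h => hyB (h ▸ he), hBS he⟩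
  obtain ⟨x, hxU, hxB⟩ := Finset.exists_of_ssubset (Finset.ssubset_iff_subset_ne.2 ⟨hBU, fun h => by
    rw [h] at hB3; omega⟩)
  refine ⟨x, hxU, ?_, rkN_eq_three_of_member (Finset.mem_filter.1 hB).1⟩
  apply Finset.eq_of_subset_of_card_le
  · intro e he
    exact Finset.mem_erase.2 ⟨fun h => hxB (h ▸ he), hBU he⟩
  · rw [Finset.card_erase_of_mem hxU, h4, hB3]

/-- `|U ∩ cl K| ≥ 3` when `|U| = 4` and `|P ∖ cl K| ≤ 1`: some `U ∖ {x}` lies in `cl K`. -/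
theorem exists_erase_subset_clF {P U K : Finset α} (hU : U ⊆ P) (h4 : U.card = 4)
    (hK : (P \ clF M K).card ≤ 1) : ∃ x ∈ U, U.erase x ⊆ clF M K := by
  have hsub : U \ clF M K ⊆ P \ clF M K := fun e he => by
    rw [Finset.mem_sdiff] at he ⊢; exact ⟨hU he.1, he.2⟩
  have hc : (U \ clF M K).card ≤ 1 := (Finset.card_le_card hsub).trans hK
  rw [Finset.card_le_one] at hc
  by_cases hne : (U \ clF M K).Nonempty
  · obtain ⟨x, hx⟩ := hne
    have hx' := Finset.mem_sdiff.1 hx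
    refine ⟨x, hx'.1, fun e he => ?_⟩
    by_contra hecl
    rw [Finset.mem_erase] at he
    exact he.1 (hc e (Finset.mem_sdiff.2 ⟨he.2, hecl⟩) x hx)
  · rw [Finset.not_nonempty_iff_eq_empty] at hne
    obtain ⟨x, hx⟩ : U.Nonempty := Finset.card_pos.1 (by omega)
    refine ⟨x, hx, fun e he => ?_⟩
    by_contra hecl
    have : e ∈ U \ clF M K := Finset.mem_sdiff.2 ⟨(Finset.mem_erase.1 he).2, hecl⟩
    rw [hne] at this
    exact absurd this (Finset.notMem_empty e)

/-- A set of `≥ 3` points of a simple flat containing two distinct points has rank `≥ 2`; combined with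
uniqueness: the collinear triples of a rank-`3` set with `≥ 4` points are at most one (`x = x'`). -/
theorem eq_of_rkN_erase_le_two {U : Finset α} (hsimple : ∀ e ∈ U, ∀ f ∈ U, e ≠ f → rkN M {e, f} = 2)
    (hr : rkN M U = 3) (h4 : 4 ≤ U.card) {x x' : α} (hx : x ∈ U) (hx' : x' ∈ U)
    (hrx : rkN M (U.erase x) ≤ 2) (hrx' : rkN M (U.erase x') ≤ 2) : x = x' := by
  have hc := card_filter_rkN_erase_eq_two_le_one hsimple hr h4
  have key : ∀ z ∈ U, rkN M (U.erase z) ≤ 2 → z ∈ U.filter (fun e => rkN M (U.erase e) = 2) := by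
    intro z hz hrz
    rw [Finset.mem_filter]
    refine ⟨hz, le_antisymm hrz ?_⟩
    -- two distinct points of `U ∖ {z}`
    have h3 : 3 ≤ (U.erase z).card := by rw [Finset.card_erase_of_mem hz]; omega
    obtain ⟨e, he⟩ : (U.erase z).Nonempty := Finset.card_pos.1 (by omega)
    have h2 : 2 ≤ ((U.erase z).erase e).card := by rw [Finset.card_erase_of_mem he]; omega
    obtain ⟨f, hf⟩ : ((U.erase z).erase e).Nonempty := Finset.card_pos.1 (by omega)
    rw [Finset.mem_erase] at hf
    have hef : ({e, f} : Finset α) ⊆ U.erase z := by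
      intro g hg
      rw [Finset.mem_insert, Finset.mem_singleton] at hg
      rcases hg with rfl | rfl
      · exact he
      · exact hf.2
    have := rkN_mono (M := M) hef
    rw [hsimple e (Finset.mem_erase.1 he).2 f (Finset.mem_erase.1 hf.2).2 (Ne.symm hf.1)] at this
    exact this
  exact Finset.card_le_one.1 hc x (key x hx hrx) x' (key x' hx' hrx')

/-- A spreading member containing `y` gives a pair `K ⊆ U` of rank `2` whose line misses at most one point
of `P`, and a collinear triple `U ∖ {x} ⊆ cl K`. -/
theorem line_of_mem_sprPre_mem {G : Finset α} (hG : G ∈ flatsQ M 4) {y : α} (hyG : y ∈ G)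
    (hycl : y ∉ clF M (G.erase y)) {S : Finset α} (hS : S ∈ shadowAt M 5 3 (Uq M 5 3) G)
    (h4 : (S.erase y).card = 4) {B : Finset α} (hB : B ∈ sprPre M G S) (hyB : y ∈ B) :
    B.erase y ⊆ S.erase y ∧ (B.erase y).card = 2 ∧ rkN M (B.erase y) = 2 ∧
      ((G.erase y) \ clF M (B.erase y)).card = 1 ∧
      ∃ x ∈ S.erase y, (S.erase y).erase x ⊆ clF M (B.erase y) ∧ rkN M ((S.erase y).erase x) ≤ 2 := by
  obtain ⟨hBS, -⟩ := card_eq_five_of_mem_sprPre hB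
  have hBm : B ∈ membersIn M (Uq M 5 3) G := (Finset.mem_filter.1 hB).1
  have hB3 : B.card = 3 := (Finset.mem_filter.1 hB).2.2.1
  have hm1 : (G \ clF M B).card = 1 := (Finset.mem_filter.1 hB).2.1
  have hKU : B.erase y ⊆ S.erase y := fun e he => by
    rw [Finset.mem_erase] at he ⊢; exact ⟨he.1, hBS he.2⟩
  have hK2 : (B.erase y).card = 2 := by rw [Finset.card_erase_of_mem hyB, hB3]
  have hKr : rkN M (B.erase y) = 2 := rkN_erase_of_member_mem hG hyG hycl hBm hyB
  have hKm : ((G.erase y) \ clF M (B.erase y)).card = 1 := by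
    rw [← card_sdiff_clF_of_member_mem hG hyG hycl hBm hyB]; exact hm1
  refine ⟨hKU, hK2, hKr, hKm, ?_⟩
  obtain ⟨x, hxU, hxsub⟩ := exists_erase_subset_clF (erase_subset_erase_of_mem_shadowAt hS) h4 hKm.le
  refine ⟨x, hxU, hxsub, ?_⟩
  have := rkN_mono (M := M) hxsub
  rwa [rkN_clF, hKr] at this

/-- The covering coloops of `S` other than `y` give collinear triples `U ∖ {z}`. -/
theorem rkN_erase_le_two_of_mem_covZ {G : Finset α} {y : α} (hycl : y ∉ clF M (G.erase y)) {S : Finset α}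
    (hS : S ∈ shadowAt M 5 3 (Uq M 5 3) G) (hyS : y ∈ S) {z : α} (hz : z ∈ covZ M G S) (hzy : z ≠ y) :
    rkN M ((S.erase y).erase z) ≤ 2 :=
  (rkN_erase_erase_eq_two hycl hS hyS (covZ_subset_coloops G S hz) hzy).le

/-- The spread part of a column is at most `#sprPre · (5/12)/(|G| − 4)`. -/
theorem sum_sprPre_le {G S : Finset α} (c : ℕ) (hc : (sprPre M G S).card ≤ c) :
    ∑ B ∈ sprPre M G S, (5 / 12 - keepW M G B) / ((G.card - 4 : ℕ) : ℚ) ≤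
      (c : ℚ) * ((5 / 12) / ((G.card - 4 : ℕ) : ℚ)) := by
  calc ∑ B ∈ sprPre M G S, (5 / 12 - keepW M G B) / ((G.card - 4 : ℕ) : ℚ)
      ≤ ∑ B ∈ sprPre M G S, (5 / 12 : ℚ) / ((G.card - 4 : ℕ) : ℚ) := by
        apply Finset.sum_le_sum
        intro B _
        apply div_le_div_of_nonneg_right _ (by positivity)
        linarith [keepW_nonneg (M := M) G B]
    _ = ((sprPre M G S).card : ℚ) * ((5 / 12) / ((G.card - 4 : ℕ) : ℚ)) := by
        rw [Finset.sum_const, nsmul_eq_mul]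
    _ ≤ (c : ℚ) * ((5 / 12) / ((G.card - 4 : ℕ) : ℚ)) := by
        have : ((sprPre M G S).card : ℚ) ≤ c := by exact_mod_cast hc
        gcongr

/-- If `y` is a covering coloop of `S` then `U = S ∖ {y}` is a member, so `|G| ≥ |U| + 3`. -/
theorem card_le_of_mem_covZ {G : Finset α} (hd : (gr M \ G).card = 2) {S : Finset α} {y : α}
    (hyZ : y ∈ covZ M G S) (hSG : S ⊆ G) : (S.erase y).card + 3 ≤ G.card := by
  have hU := erase_mem_of_mem_covZ hyZ
  have h3 := three_le_card_sdiff_of_member hd hU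
  have := Finset.card_sdiff_add_card_eq_card ((Finset.erase_subset y S).trans hSG)
  omega

/-! ## `|U| = 4`, no collinear triple -/

open scoped Classical in
/-- **No collinear triple**: the column is `≤ 35/36`. -/
theorem sum_r1W_col_le_of_card_four_of_no_collinear {G : Finset α} (hG : G ∈ flatsQ M 4)
    (hd : (gr M \ G).card = 2) (h6 : 6 ≤ G.card) {y : α} (hyG : y ∈ G) (hycl : y ∉ clF M (G.erase y))
    {S : Finset α} (hS : S ∈ shadowAt M 5 3 (Uq M 5 3) G) (h4 : (S.erase y).card = 4)
    (hno : ∀ x ∈ S.erase y, ¬ rkN M ((S.erase y).erase x) ≤ 2) :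
    ∑ B ∈ membersIn M (Uq M 5 3) G, r1W M G B S ≤ 35 / 36 := by
  have hyS := mem_of_mem_shadowAt_coloop hyG hycl hS
  rw [sum_r1W_col_eq hS]
  -- covering coloops: only `y`
  have hZ : covZ M G S ⊆ {y} := by
    intro z hz
    rw [Finset.mem_singleton]
    by_contra hzy
    exact hno z (Finset.mem_erase.2 ⟨hzy, mem_of_mem_covZ hz⟩) (rkN_erase_le_two_of_mem_covZ hycl hS hyS hz hzy)
  -- spreading members: the triangles `U ∖ {x}`
  have hspr : sprPre M G S ⊆ (S.erase y).image (fun x => (S.erase y).erase x) := by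
    intro B hB
    by_cases hyB : y ∈ B
    · obtain ⟨-, -, -, -, x, hxU, -, hxr⟩ := line_of_mem_sprPre_mem hG hyG hycl hS h4 hB hyB
      exact absurd hxr (hno x hxU)
    · obtain ⟨x, hxU, rfl, -⟩ := eq_erase_of_mem_sprPre_notMem hyS h4 hB hyB
      exact Finset.mem_image_of_mem _ hxU
  have hcard : (sprPre M G S).card ≤ 4 := by
    calc (sprPre M G S).card ≤ ((S.erase y).image (fun x => (S.erase y).erase x)).card :=
          Finset.card_le_card hspr
      _ ≤ (S.erase y).card := Finset.card_image_le
      _ = 4 := h4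
  have hsprsum := sum_sprPre_le (M := M) (G := G) (S := S) 4 hcard
  by_cases hyZ : y ∈ covZ M G S
  · have hZeq : covZ M G S = {y} := Finset.eq_singleton_iff_unique_mem.2 ⟨hyZ, fun z hz => Finset.mem_singleton.1 (hZ hz)⟩
    have h7 : 7 ≤ G.card := by
      have := card_le_of_mem_covZ hd hyZ (subset_of_mem_shadowAt hS); omega
    rw [hZeq, Finset.sum_singleton]
    have hcov := covW_erase_le hG hyZ
    have h3 : (3 : ℚ) ≤ ((G.card - 4 : ℕ) : ℚ) := by exact_mod_cast (by omega : 3 ≤ G.card - 4)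
    have : (4 : ℚ) * ((5 / 12) / ((G.card - 4 : ℕ) : ℚ)) ≤ 5 / 9 := by
      rw [← mul_div_assoc, div_le_iff₀ (by linarith)]
      linarith
    linarith
  · have hZeq : covZ M G S = ∅ := by
      apply Finset.eq_empty_of_forall_notMem
      intro z hz
      have := hZ hz
      rw [Finset.mem_singleton] at this
      exact hyZ (this ▸ hz)
    rw [hZeq, Finset.sum_empty, zero_add]
    have h2 : (2 : ℚ) ≤ ((G.card - 4 : ℕ) : ℚ) := by exact_mod_cast (by omega : 2 ≤ G.card - 4)
    have : (4 : ℚ) * ((5 / 12) / ((G.card - 4 : ℕ) : ℚ)) ≤ 5 / 6 := by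
      rw [← mul_div_assoc, div_le_iff₀ (by linarith)]
      linarith
    linarith

/-- `G ∖ {y} ⊆ insert z₀ L` when `(G ∖ {y}) ∖ L = {z₀}`. -/
theorem erase_subset_insert_of_sdiff_eq {G L : Finset α} {y z₀ : α} (h : (G.erase y) \ L = {z₀}) :
    G.erase y ⊆ insert z₀ L := by
  intro e he
  rw [Finset.mem_insert]
  by_cases heL : e ∈ L
  · exact Or.inr heL
  · left
    have : e ∈ (G.erase y) \ L := Finset.mem_sdiff.2 ⟨he, heL⟩
    rw [h, Finset.mem_singleton] at this
    exact this

/-- With a collinear triple `K₀ = U ∖ {z₀}` whose line misses exactly one point of `P`, that point is `z₀`: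
`(G ∖ {y}) ∖ cl K₀ = {z₀}`. -/
theorem sdiff_clF_eq_singleton_of_m_one {G : Finset α} (hGg : G ⊆ gr M) {y : α} {S : Finset α}
    (hU : S.erase y ⊆ G.erase y) (hr : rkN M (S.erase y) = 3) {z₀ : α} (hz₀ : z₀ ∈ S.erase y)
    (hz₀r : rkN M ((S.erase y).erase z₀) ≤ 2)
    (hm : ((G.erase y) \ clF M ((S.erase y).erase z₀)).card = 1) :
    (G.erase y) \ clF M ((S.erase y).erase z₀) = {z₀} := by
  have hUg : S.erase y ⊆ gr M := hU.trans ((Finset.erase_subset _ _).trans hGg)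
  have hz₀cl : z₀ ∉ clF M ((S.erase y).erase z₀) := by
    intro h
    have hsub : S.erase y ⊆ clF M ((S.erase y).erase z₀) := by
      intro e he
      by_cases hez : e = z₀
      · rw [hez]; exact h
      · exact subset_clF_of_subset_gr ((Finset.erase_subset _ _).trans hUg) (Finset.mem_erase.2 ⟨hez, he⟩)
    have := rkN_mono (M := M) hsub
    rw [rkN_clF] at this
    omega
  have hmem : z₀ ∈ (G.erase y) \ clF M ((S.erase y).erase z₀) := Finset.mem_sdiff.2 ⟨hU hz₀, hz₀cl⟩
  obtain ⟨c, hc⟩ := Finset.card_eq_one.1 hm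
  rw [hc] at hmem ⊢
  rw [Finset.mem_singleton] at hmem
  rw [hmem]

/-- A `2`-subset of a set of pairwise-rank-`2` points has rank `2`. -/
theorem rkN_eq_two_of_card_two {G K : Finset α} (hsimple : ∀ e ∈ G, ∀ f ∈ G, e ≠ f → rkN M {e, f} = 2)
    (hK : K ⊆ G) (h2 : K.card = 2) : rkN M K = 2 := by
  obtain ⟨a, b, hab, rfl⟩ := Finset.card_eq_two.1 h2
  exact hsimple a (hK (Finset.mem_insert_self _ _)) b (hK (Finset.mem_insert_of_mem (Finset.mem_singleton_self _)))
    hab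

/-- A set of `≥ 3` points of a simple flat with rank `≤ 2` has rank exactly `2`. -/
theorem rkN_eq_two_of_le_two {G K : Finset α} (hsimple : ∀ e ∈ G, ∀ f ∈ G, e ≠ f → rkN M {e, f} = 2)
    (hK : K ⊆ G) (h2 : 2 ≤ K.card) (hr : rkN M K ≤ 2) : rkN M K = 2 := by
  apply le_antisymm hr
  obtain ⟨e, he⟩ : K.Nonempty := Finset.card_pos.1 (by omega)
  obtain ⟨f, hf⟩ : (K.erase e).Nonempty := Finset.card_pos.1 (by rw [Finset.card_erase_of_mem he]; omega)
  rw [Finset.mem_erase] at hf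
  have hef : ({e, f} : Finset α) ⊆ K := by
    intro g hg
    rw [Finset.mem_insert, Finset.mem_singleton] at hg
    rcases hg with rfl | rfl
    · exact he
    · exact hf.2
  have := rkN_mono (M := M) hef
  rwa [hsimple e (hK he) f (hK hf.2) (Ne.symm hf.1)] at this

end PercRepro.Shadow
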